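import Mathlib.NumberTheory.LegendreSymbol.QuadraticChar.Basic
import Summits.BirchSwinnertonDyer.Rank1Residual.Additive.ChiBranchInput
import Literature.NumberTheory.EllipticCurves.Wuthrich2014.PAdicBSDInequalityProofs
import Literature.NumberTheory.EllipticCurves.PAdicLFunctionBranchConstantTermProofs
import Literature.NumberTheory.EllipticCurves.PAdicLFunctionInterpolationHoldsProofs
import Literature.NumberTheory.EllipticCurves.PAdicLFunctionDistributionProofs
import HarnessLib

/-!
# The `ω^{(p−1)/2}`-branch of `L_p(E♭, T)` at `T = 0`: `α⁻¹ · ∑_{a mod p} (a/p)[a/p]⁺_f` (cell `b2b-bsdres`, seat additive-p4, line V9, link [D])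

HONEST FRAMING (cell `b2b-bsdres`, run/shared/lean/b2b/bsd-rank1-residual/, verbatim in every
file): the goal of the cell is to DELETE the COMBINATION-SHAPED residual classes of the
Birch–Swinnerton-Dyer formula for ALL analytic-rank `≤ 1` elliptic curves over `ℚ` — "full BSD
formula for every rank `≤ 1` curve in class `C`" assembled STRICTLY from published theorems — so
that the rank-`≤ 1` remainder becomes exactly the CONSTRUCTION-SHAPED classes, which are TYPED
(missing-input `Prop`s), NOT attempted. This is not "finishing BSD". The additive sub-cell (seats
additive-p1…p4) is a RESEARCH ROUTE on the construction-shaped classes X3/X4; no claim beyond the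
stated classes; the label of X3 is UNCHANGED.

Theorems only (no definition, no named fact). Link [D] of the research line V9
(HOME/b2b-bsdres-additive-p4/V9-CHAIN.md), PROVED: for a globally minimal `V/ℚ` good ordinary at an
odd prime `p` with newform `f` and unit root `α = unitRoot V p`, the constant term of the
`ω^{(p−1)/2}`-branch of the Mazur–Tate–Teitelbaum `p`-adic `L`-function (tree
`padicLFunctionBranch f α (p / 2)`, p200573) is
`L_p(f, α, ω^{(p−1)/2}, 0) = α⁻¹ · ∑_{a mod p} (a/p)·[a/p]⁺_f = α⁻¹ · legendrePlusSymbolSum f p`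
(`constantCoeff_padicLFunctionBranch_half`). Ingredients: the tree's constant-term theorem for the
branches (p202627: `= ∑_{a ∈ (ℤ/p)ˣ} μ_{f,α}(a + pℤ_p)·ω(a)^{(p−1)/2}`, from the distribution
relation, discharged for `(f, α)` by `msdMeasure_distribution_of_isNewformOf`), the measure
`μ(a + pℤ_p) = α⁻¹[a/p]⁺ − α⁻²[0]⁺` (MTT (10.1), `[a]⁺ = [0]⁺`), EULER'S CRITERION for the
Teichmüller character (`teichRep_pow_half_eq_legendreSym`: `ω(a)^{(p−1)/2} = (a/p)` in `ℤ_p` — both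
are `±1`, they agree modulo `p`, and `1 ≢ −1`), and `∑_a (a/p) = 0`. Consequence
(`constantCoeff_eq_of_iwasawaToPowerSeries_eq_branch`): the full even-branch typed input
`ChiBranchDivisibilityAt` of `ChiBranchInput.lean` (`ι g = ϖ·L_p(f, α, ω^{(p−1)/2}, T)`) yields the
`T = 0` input (`g(0) = α⁻¹·ϖ·∑(a/p)[a/p]⁺_f`, `α⁻¹ ∈ ℤ_p^×`) pointwise. Consumer:
`Additive/X3RankZeroSemistableTwist.lean`.

References: Mazur–Tate–Teitelbaum 1986 [MazurTateTeitelbaum1986Invent] §I.10 (10.1), §I.13,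
§I.14 (14.3); Washington, *Cyclotomic Fields* §5.1 (Teichmüller character).
-/

noncomputable section

open scoped Classical MatrixGroups ModularForm

open CongruenceSubgroup WeierstrassCurve Literature.NumberTheory.EllipticCurves
  Literature.NumberTheory.EllipticCurves.ModularForms
  Literature.NumberTheory.EllipticCurves.Rank1Residual

namespace Summit.BirchSwinnertonDyer.Rank1Residual.Additive

/-! ## §1 The `ω^{(p−1)/2}`-branch at `T = 0`: `L_p(f, α, ω^{(p−1)/2}, 0) = α⁻¹ · ∑_{a mod p} (a/p) [a/p]⁺_f` -/

section Branch

variable (p : ℕ) [hp : Fact p.Prime]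

omit hp in
/-- For odd `p` the `2`-part exponent `e₀` of the cyclotomic tower is `1`. -/
theorem cyclotomicExponent_eq_one (hp2 : p ≠ 2) : cyclotomicExponent p = 1 := by
  unfold cyclotomicExponent
  rw [if_neg hp2]

omit hp in
/-- For odd `p`, `p ^ e₀ = p`. -/
theorem pow_cyclotomicExponent_eq (hp2 : p ≠ 2) : p ^ cyclotomicExponent p = p := by
  rw [cyclotomicExponent_eq_one p hp2, pow_one]

variable {p} in
/-- The MSD measure at level `e = n + 1` (equation lemma with the level abstracted, so that it
applies at `e = e₀` without rewriting inside `ZMod (p ^ e₀)`). -/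
theorem msdMeasure_of_eq_succ {N : ℕ} (f : CuspForm (Gamma0 N) 2) (α : ℚ_[p]) {e n : ℕ}
    (h : e = n + 1) (a : ZMod (p ^ e)) :
    msdMeasure f α e a =
      α⁻¹ ^ (n + 1) * (ratPlusSymbol f ((a.val : ℚ) / (p : ℚ) ^ (n + 1)) : ℚ_[p]) -
        α⁻¹ ^ (n + 2) * (ratPlusSymbol f ((a.val : ℚ) / (p : ℚ) ^ n) : ℚ_[p]) := by
  subst h
  rfl

/-- **Euler's criterion for the Teichmüller character**: for odd `p` and a unit class `a` modulo
`p^{e₀} = p`, `ω(a)^{(p−1)/2} = (a/p)` in `ℤ_p` — both sides are `±1` and they agree modulo `p`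
(`ω(a) ≡ a`, `(a/p) ≡ a^{(p−1)/2}`), and `1 ≢ −1 (mod p)`. -/
theorem teichRep_pow_half_eq_legendreSym (hp2 : p ≠ 2)
    (a : (ZMod (p ^ cyclotomicExponent p))ˣ) :
    (((teichRep p a : rootsOfUnity (torsionOrder p) ℤ_[p]) : ℤ_[p]ˣ) : ℤ_[p]) ^ (p / 2) =
      (legendreSym p ((a : ZMod (p ^ cyclotomicExponent p)).val : ℤ) : ℤ_[p]) := by
  have hpP : p.Prime := hp.out
  have hpe : p ^ cyclotomicExponent p = p := pow_cyclotomicExponent_eq p hp2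
  have hodd : Odd p := hpP.odd_of_ne_two hp2
  set t : ℤ_[p] := (((teichRep p a : rootsOfUnity (torsionOrder p) ℤ_[p]) : ℤ_[p]ˣ) : ℤ_[p])
    with ht
  set ζ : ℤ_[p] := t ^ (p / 2) with hζ
  -- `ζ² = ω(a)^{p-1} = 1`
  have hτ : torsionOrder p = 2 * (p / 2) := by
    rw [torsionOrder_eq, if_neg hp2]
    obtain ⟨k, hk⟩ := hodd
    omega
  have hζsq : ζ * ζ = 1 := by
    have h1 : ((teichRep p a : rootsOfUnity (torsionOrder p) ℤ_[p]) : ℤ_[p]ˣ) ^ torsionOrder p = 1 :=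
      (mem_rootsOfUnity _ _).mp (teichRep p a).2
    have h2 : t ^ torsionOrder p = 1 := by
      rw [ht, ← Units.val_pow_eq_pow_val, h1, Units.val_one]
    rw [hζ, ← pow_add, ← two_mul, ← hτ, h2]
  have hζpm : ζ = 1 ∨ ζ = -1 := mul_self_eq_one_iff.mp hζsq
  -- reduction modulo `p`: `ω(a) ↦ a`
  set ψ : ZMod (p ^ cyclotomicExponent p) ≃+* ZMod p := ZMod.ringEquivCongr hpe with hψ
  have hred : PadicInt.toZModPow (cyclotomicExponent p) t = (a : ZMod (p ^ cyclotomicExponent p)) := by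
    rw [ht, ← val_teichReduce, teichReduce_teichRep]
  set b : ZMod p := ψ (a : ZMod (p ^ cyclotomicExponent p)) with hb
  have hbval : b = (((a : ZMod (p ^ cyclotomicExponent p)).val : ℤ) : ZMod p) := by
    rw [Int.cast_natCast, hb]
    conv_lhs => rw [← ZMod.natCast_zmod_val (a : ZMod (p ^ cyclotomicExponent p))]
    rw [map_natCast]
  have hb0 : b ≠ 0 := by
    rw [hb]
    exact (Units.isUnit a).map ψ |>.ne_zero
  -- `ψ (ζ mod p^{e₀}) = b ^ (p/2) = ((a/p) : ZMod p)`
  have hζred : ψ (PadicInt.toZModPow (cyclotomicExponent p) ζ) =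
      (legendreSym p ((a : ZMod (p ^ cyclotomicExponent p)).val : ℤ) : ZMod p) := by
    rw [legendreSym.eq_pow, ← hbval, hζ, map_pow, map_pow, hred]
  -- compare the two signs
  haveI : Fact (2 < p) := ⟨lt_of_le_of_ne hpP.two_le (Ne.symm hp2)⟩
  have hleg : legendreSym p ((a : ZMod (p ^ cyclotomicExponent p)).val : ℤ) = 1 ∨
      legendreSym p ((a : ZMod (p ^ cyclotomicExponent p)).val : ℤ) = -1 :=
    legendreSym.eq_one_or_neg_one p (by rw [← hbval]; exact hb0)
  rcases hζpm with h1 | h1 <;> rcases hleg with h2 | h2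
  · rw [h1, h2, Int.cast_one]
  · exfalso
    rw [h1, h2, map_one, map_one, Int.cast_neg, Int.cast_one] at hζred
    exact ZMod.neg_one_ne_one hζred.symm
  · exfalso
    rw [h1, h2, map_neg, map_one, map_neg, map_one, Int.cast_one] at hζred
    exact ZMod.neg_one_ne_one hζred
  · rw [h1, h2, Int.cast_neg, Int.cast_one]

/-- Reindexing the unit classes modulo `p^{e₀} = p` (odd `p`) by all residues modulo `p`, for a
summand that vanishes on the multiples of `p`. -/
theorem sum_units_cyclotomicExponent_eq (hp2 : p ≠ 2) {M : Type*} [AddCommMonoid M]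
    (F : ℕ → M) (hF : ∀ n, p ∣ n → F n = 0) :
    ∑ a : (ZMod (p ^ cyclotomicExponent p))ˣ, F (a : ZMod (p ^ cyclotomicExponent p)).val =
      ∑ y : ZMod p, F y.val := by
  classical
  have hpP : p.Prime := hp.out
  have hpe : p ^ cyclotomicExponent p = p := pow_cyclotomicExponent_eq p hp2
  haveI : NeZero (p ^ cyclotomicExponent p) := ⟨by rw [hpe]; exact hpP.ne_zero⟩
  set ψ : ZMod (p ^ cyclotomicExponent p) ≃+* ZMod p := ZMod.ringEquivCongr hpe with hψ
  -- units ↦ all residues (the summand vanishes off the units)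
  have h1 : ∑ a : (ZMod (p ^ cyclotomicExponent p))ˣ, F (a : ZMod (p ^ cyclotomicExponent p)).val =
      ∑ x ∈ (Finset.univ : Finset (ZMod (p ^ cyclotomicExponent p))).filter IsUnit, F x.val := by
    refine Finset.sum_bij (fun a _ ↦ (a : ZMod (p ^ cyclotomicExponent p))) (fun a _ ↦ ?_)
      (fun a₁ _ a₂ _ h ↦ Units.ext h) (fun x hx ↦ ?_) (fun a _ ↦ rfl)
    · exact Finset.mem_filter.mpr ⟨Finset.mem_univ _, Units.isUnit a⟩
    · obtain ⟨-, hx⟩ := Finset.mem_filter.mp hx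
      exact ⟨hx.unit, Finset.mem_univ _, hx.unit_spec⟩
  have h2 : ∑ x ∈ (Finset.univ : Finset (ZMod (p ^ cyclotomicExponent p))).filter IsUnit, F x.val =
      ∑ x : ZMod (p ^ cyclotomicExponent p), F x.val := by
    rw [Finset.sum_filter]
    refine Finset.sum_congr rfl fun x _ ↦ ?_
    split_ifs with hx
    · rfl
    · refine (hF _ ?_).symm
      have hx' : ¬ IsUnit ((x.val : ℕ) : ZMod (p ^ cyclotomicExponent p)) := by
        rwa [ZMod.natCast_zmod_val]
      rw [ZMod.isUnit_iff_coprime] at hx'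
      by_contra h
      exact hx' (Nat.Coprime.pow_right _ (hpP.coprime_iff_not_dvd.mpr h).symm)
  have h3 : ∑ x : ZMod (p ^ cyclotomicExponent p), F x.val = ∑ y : ZMod p, F y.val :=
    Fintype.sum_equiv ψ.toEquiv _ _ fun x ↦ by
      rw [RingEquiv.toEquiv_eq_coe, EquivLike.coe_coe, hψ, ZMod.ringEquivCongr_val]
  rw [h1, h2, h3]

/-- `∑_{a mod p} (a/p) = 0` over the residues modulo `p` (a non-trivial character sums to zero). -/
theorem sum_legendreSym_val_eq_zero (hp2 : p ≠ 2) :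
    ∑ y : ZMod p, (legendreSym p (y.val : ℤ) : ℤ) = 0 := by
  have hchar : ringChar (ZMod p) ≠ 2 := by rwa [ZMod.ringChar_zmod_n]
  have h := quadraticChar_sum_zero hchar
  refine (Finset.sum_congr rfl fun y _ ↦ ?_).trans h
  rw [legendreSym, Int.cast_natCast, ZMod.natCast_zmod_val]

/-- **The `ω^{(p−1)/2}`-branch of `L_p(E♭, T)` at `T = 0`** (Mazur–Tate–Teitelbaum 1986 §I.14 at
the quadratic character of conductor `p`, `p` odd): for `V/ℚ` globally minimal, good ordinary at
`p`, with newform `f` and unit root `α`,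
`L_p(f, α, ω^{(p−1)/2}, 0) = α⁻¹ · ∑_{a mod p} (a/p) [a/p]⁺_f` — from the tree's constant-term
theorem (`constantCoeff_padicLFunctionBranch_eq`, p202627: `= ∑_{a ∈ (ℤ/p)ˣ} μ_{f,α}(a + pℤ_p) ω(a)^{(p−1)/2}`),
the measure `μ(a + pℤ_p) = α⁻¹[a/p]⁺ − α⁻²[0]⁺` (MTT (10.1), `[a]⁺ = [0]⁺`), Euler's criterion
`ω(a)^{(p−1)/2} = (a/p)` and `∑_a (a/p) = 0`. -/
theorem constantCoeff_padicLFunctionBranch_half (hp2 : p ≠ 2) {N : ℕ} [NeZero N]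
    {f : CuspForm (Gamma0 N) 2} (V : WeierstrassCurve ℚ) [V.IsElliptic] [V.IsGloballyMinimal]
    (hord : IsOrdinaryAt V p) (hf : IsNewformOf V f) :
    PowerSeries.constantCoeff (padicLFunctionBranch f (unitRoot V p : ℚ_[p]) (p / 2)) =
      (unitRoot V p : ℚ_[p])⁻¹ * (legendrePlusSymbolSum f p : ℚ_[p]) := by
  classical
  have hpP : p.Prime := hp.out
  have he : cyclotomicExponent p = 0 + 1 := by rw [zero_add]; exact cyclotomicExponent_eq_one p hp2
  have hpe : p ^ cyclotomicExponent p = p := pow_cyclotomicExponent_eq p hp2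
  set α : ℚ_[p] := (unitRoot V p : ℚ_[p]) with hα
  rw [constantCoeff_padicLFunctionBranch_eq (msdMeasure_distribution_of_isNewformOf hord hf) (p / 2)]
  -- the summand: `μ(a + pℤ_p) ω(a)^{(p-1)/2} = (α⁻¹ [a/p]⁺ − α⁻² [0]⁺) (a/p)`
  have hsummand : ∀ a : (ZMod (p ^ cyclotomicExponent p))ˣ,
      msdMeasure f α (cyclotomicExponent p) (a : ZMod (p ^ cyclotomicExponent p)) *
          ((((teichRep p a : rootsOfUnity (torsionOrder p) ℤ_[p]) : ℤ_[p]ˣ) : ℤ_[p]) : ℚ_[p]) ^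
            (p / 2) =
        α⁻¹ * ((legendreSym p ((a : ZMod (p ^ cyclotomicExponent p)).val : ℤ) : ℚ_[p]) *
            (ratPlusSymbol f (((a : ZMod (p ^ cyclotomicExponent p)).val : ℚ) / p) : ℚ_[p])) -
          α⁻¹ ^ 2 * (ratPlusSymbol f 0 : ℚ_[p]) *
            (legendreSym p ((a : ZMod (p ^ cyclotomicExponent p)).val : ℤ) : ℚ_[p]) := by
    intro a
    have hteich : ((((teichRep p a : rootsOfUnity (torsionOrder p) ℤ_[p]) : ℤ_[p]ˣ) : ℤ_[p]) :
        ℚ_[p]) ^ (p / 2) =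
        (legendreSym p ((a : ZMod (p ^ cyclotomicExponent p)).val : ℤ) : ℚ_[p]) := by
      rw [← PadicInt.coe_pow, teichRep_pow_half_eq_legendreSym p hp2 a, PadicInt.coe_intCast]
    have hper : ratPlusSymbol f (((a : ZMod (p ^ cyclotomicExponent p)).val : ℚ) / (p : ℚ) ^ 0) =
        ratPlusSymbol f 0 := by
      rw [pow_zero, div_one, ← ratPlusSymbol_add_intCast_eq f 0
        ((a : ZMod (p ^ cyclotomicExponent p)).val : ℤ)]
      push_cast
      rw [zero_add]
    rw [hteich, msdMeasure_of_eq_succ f α he, hper, zero_add, pow_one, pow_one]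
    ring
  rw [Fintype.sum_congr _ _ hsummand, Finset.sum_sub_distrib, ← Finset.mul_sum, ← Finset.mul_sum]
  -- the main term, reindexed over `ℤ/p`
  have hmain : ∑ a : (ZMod (p ^ cyclotomicExponent p))ˣ,
      ((legendreSym p ((a : ZMod (p ^ cyclotomicExponent p)).val : ℤ) : ℚ_[p]) *
        (ratPlusSymbol f (((a : ZMod (p ^ cyclotomicExponent p)).val : ℚ) / p) : ℚ_[p])) =
      (legendrePlusSymbolSum f p : ℚ_[p]) := by
    rw [sum_units_cyclotomicExponent_eq p hp2
      (fun n : ℕ ↦ ((legendreSym p (n : ℤ) : ℚ_[p]) * (ratPlusSymbol f ((n : ℚ) / p) : ℚ_[p])))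
      (fun n hn ↦ by
        rw [(legendreSym.eq_zero_iff p (n : ℤ)).mpr (by exact_mod_cast (ZMod.natCast_eq_zero_iff n p).mpr hn)]
        push_cast
        ring)]
    rw [legendrePlusSymbolSum_def]
    push_cast
    rfl
  -- the error term vanishes: `∑_a (a/p) = 0`
  have herr : ∑ a : (ZMod (p ^ cyclotomicExponent p))ˣ,
      ((legendreSym p ((a : ZMod (p ^ cyclotomicExponent p)).val : ℤ) : ℚ_[p])) = 0 := by
    rw [sum_units_cyclotomicExponent_eq p hp2 (fun n : ℕ ↦ ((legendreSym p (n : ℤ) : ℚ_[p])))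
      (fun n hn ↦ by
        rw [(legendreSym.eq_zero_iff p (n : ℤ)).mpr (by exact_mod_cast (ZMod.natCast_eq_zero_iff n p).mpr hn)]
        push_cast
        rfl)]
    have h := sum_legendreSym_val_eq_zero p hp2
    have h' := congrArg (fun z : ℤ ↦ (z : ℚ_[p])) h
    push_cast at h'
    exact h'
  rw [hmain, herr, mul_zero, sub_zero]

/-- From the full even branch to its value at `T = 0`: if `ι g = ϖ · L_p(f, α, ω^{(p−1)/2}, T)`
for the newform `f` of a good ordinary `V` and `α = unitRoot V p`, then
`g(0) = α⁻¹ · ϖ · ∑_{a mod p} (a/p) [a/p]⁺_f` with `α⁻¹ ∈ ℤ_p^×`. -/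
theorem constantCoeff_eq_of_iwasawaToPowerSeries_eq_branch (hp2 : p ≠ 2) {N : ℕ} [NeZero N]
    {f : CuspForm (Gamma0 N) 2} (V : WeierstrassCurve ℚ) [V.IsElliptic] [V.IsGloballyMinimal]
    (hord : IsOrdinaryAt V p) (hf : IsNewformOf V f) {g : IwasawaAlgebra p} {ϖ : ℚ}
    (hg : iwasawaToPowerSeries p g =
      PowerSeries.C ((ϖ : ℚ) : ℚ_[p]) * padicLFunctionBranch f (unitRoot V p : ℚ_[p]) (p / 2)) :
    ∃ u : ℤ_[p]ˣ, ((PowerSeries.constantCoeff g : ℤ_[p]) : ℚ_[p]) =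
      ((u : ℤ_[p]) : ℚ_[p]) * (ϖ : ℚ_[p]) * (legendrePlusSymbolSum f p : ℚ_[p]) := by
  obtain ⟨-, hunit⟩ := unitRoot_spec_holds V p hord
  set u : ℤ_[p]ˣ := hunit.unit with hu
  refine ⟨u⁻¹, ?_⟩
  have hcoe : ((u : ℤ_[p]) : ℚ_[p]) = (unitRoot V p : ℚ_[p]) := by rw [hu, IsUnit.unit_spec]
  have hinv : (((u⁻¹ : ℤ_[p]ˣ) : ℤ_[p]) : ℚ_[p]) = (unitRoot V p : ℚ_[p])⁻¹ := by
    rw [← hcoe]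
    refine eq_inv_of_mul_eq_one_left ?_
    rw [← PadicInt.coe_mul, Units.inv_mul, PadicInt.coe_one]
  have h0 := congrArg PowerSeries.constantCoeff hg
  rw [map_mul, PowerSeries.constantCoeff_C, constantCoeff_padicLFunctionBranch_half p hp2 V hord hf,
    ← PowerSeries.coeff_zero_eq_constantCoeff_apply, Wuthrich2014.coeff_iwasawaToPowerSeries,
    PowerSeries.coeff_zero_eq_constantCoeff] at h0
  rw [h0, hinv]
  ring

end Branch

end Summit.BirchSwinnertonDyer.Rank1Residual.Additive

end
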